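import Mathlib
import Summits.AtomisticToContinuum.Crystallization.Theses.PricedLinkCensus
import Summits.AtomisticToContinuum.Crystallization.Theorems.ChargedEnergyGap.Negative.Unconditional
import Summits.AtomisticToContinuum.Crystallization.Theorems.PricedLinkCensusStackingHingeHcpChargedOfPriced
import Literature.MathematicalPhysics.StatisticalMechanics.LennardJonesClusters
import Literature.MathematicalPhysics.StatisticalMechanics.BarlowStacking
import Literature.MathematicalPhysics.StatisticalMechanics.HaggStacking

/-!
# Route PricedLinkCensus — the squeeze of line Sketch (weak hcp windows) for `StackingHinge`
(stub `stub_hcpCharged_of_weak` of line Sketch, stmt-AtomisticToContinuum-14993)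

Fix an hcp scale `(a, h)` and suppose the WEAK FINITE FORM of the hard stub of the line holds for
it (`WeakHcpWindowsAt a h`, inlined in the signature): for all `(δ₀, R, ε)` there are
`η, β, L, ρ > 0` such that for every injective `δ₀`-separated `y : Fin N → ℝ³` with

  `#B_L ≤ β·N`  and  `E_LJ(y) ≤ N·(e* + η)`,

at least `ρ·N` sites have their `R`-window two-way `ε`-matched with a rigid image of the hcp
stacking `barlowStacking a h alternatingHagg`.  Here `e* = ⨅_Q e_LJ(Q)` is the periodic infimum
and `B_L` is the set of sites `i` whose `L·nn_i`-window contains a site that is not charge-free at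
tolerance `1/100`.  Suppose also `ChargeFreeWindows`.  Then along every sequence `x N` of
Lennard-Jones ground states and for every window `(R, ε)` there is `ρ > 0` with `ρ N ≤ #M`
eventually (a fortiori frequently), `M` the matched sites.

Proof.  `δ₀` from `LennardJonesMinimalDistance_holds`; `η, β, L, ρ` from the hypothesis at
`(δ₀, R, ε)`; a ground state is injective, `δ₀`-separated and has `interactionEnergy = E(N)`;
`E(N)/N → e*` (`ChargedEnergyGapNegative.crysEnergyLimit`) gives eventually `E(N) < N (e* + η)`,
and `#B_L/N → 0` (`ChargeFreeWindows` at radius `L`) gives eventually `#B_L < β N` (both for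
`N ≥ 1`); so eventually both premises of the weak form hold at `y = x N`.

All `[folklore]`; pure bookkeeping (Mathlib filters).
-/

namespace Summit.AtomisticToContinuum.Crystallization.Theorems.PricedHcpWindowsWeakSqueeze

open Filter Topology
open Literature.MathematicalPhysics.StatisticalMechanics
open Literature.Geometry.DiscreteGeometry

/-- **The squeeze, weak form** (stub `stub_hcpCharged_of_weak` of line Sketch for
`StackingHinge`).  If the weak finite form of the hard stub holds for the hcp scale `(a, h)` (for
all `(δ₀, R, ε)` there are `η, β, L, ρ > 0` such that every injective `δ₀`-separated
configuration with `#B_L ≤ β N` bad `L`-windows and energy `≤ N (e* + η)` has `≥ ρ N` sites whose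
`R`-window is two-way `ε`-matched with a rigid image of `barlowStacking a h alternatingHagg`) and
`ChargeFreeWindows` holds, then along every sequence of Lennard-Jones ground states and for every
window `(R, ε)` the matched sites have positive upper density.  Proof: `δ₀` from
`LennardJonesMinimalDistance_holds`; `η, β, L, ρ` from the hypothesis at `(δ₀, R, ε)`; ground
states are injective, `δ₀`-separated, with `interactionEnergy = groundStateEnergy`;
`E(N)/N → e*` (`ChargedEnergyGapNegative.crysEnergyLimit`) and `#B_L/N → 0` (`ChargeFreeWindows`
at radius `L`) make both premises hold eventually; `Filter.Eventually.frequently`. [folklore] -/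
theorem stub_hcpCharged_of_weak : ∀ (a h : ℝ), (∀ δ₀ : ℝ, 0 < δ₀ → ∀ R ε : ℝ, 0 < R → 0 < ε → ∃ η β L ρ : ℝ, 0 < η ∧ 0 < β ∧ 0 < L ∧ 0 < ρ ∧ ∀ (N : ℕ) (y : Fin N → EuclideanSpace ℝ (Fin 3)), Function.Injective y → (∀ i j : Fin N, i ≠ j → δ₀ ≤ dist (y i) (y j)) → (Nat.card {i : Fin N // ¬ (∀ j : Fin N, dist (y i) (y j) ≤ L * Literature.Geometry.DiscreteGeometry.nearestDist y i → Literature.Geometry.DiscreteGeometry.IsChargeFree (1 / 100 : ℝ) y j)} : ℝ) ≤ β * N → Literature.MathematicalPhysics.StatisticalMechanics.interactionEnergy Literature.MathematicalPhysics.StatisticalMechanics.lennardJones y ≤ (N : ℝ) * ((⨅ Q : Literature.MathematicalPhysics.StatisticalMechanics.PeriodicConfiguration 3, Q.energyPerParticle Literature.MathematicalPhysics.StatisticalMechanics.lennardJones) + η) → ρ * (N : ℝ) ≤ (Nat.card {i : Fin N // ∃ g : EuclideanSpace ℝ (Fin 3) ≃ᵃⁱ[ℝ] EuclideanSpace ℝ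 (Fin 3), (∀ j : Fin N, dist (y i) (y j) ≤ R → ∃ z ∈ Literature.MathematicalPhysics.StatisticalMechanics.barlowStacking a h Literature.MathematicalPhysics.StatisticalMechanics.alternatingHagg, dist (y j) (g z) ≤ ε) ∧ (∀ z ∈ Literature.MathematicalPhysics.StatisticalMechanics.barlowStacking a h Literature.MathematicalPhysics.StatisticalMechanics.alternatingHagg, dist (y i) (g z) ≤ R → ∃ j : Fin N, dist (y j) (g z) ≤ ε)} : ℝ)) → Summit.AtomisticToContinuum.Crystallization.Theses.PricedLinkCensus.ChargeFreeWindows → ∀ x : (N : ℕ) → (Fin N → EuclideanSpace ℝ (Fin 3)), (∀ N, Literature.MathematicalPhysics.StatisticalMechanics.IsGroundState Literature.MathematicalPhysics.StatisticalMechanics.lennardJones (x N)) → ∀ R ε : ℝ, 0 < R → 0 < ε → ∃ ρ : ℝ, 0 < ρ ∧ ∃ᶠ N : ℕ in Filter.atTop, ρ * (N : ℝ) ≤ (Nat.card {i : Fin N // ∃ g : EuclideanSpace ℝ (Fin 3) ≃ᵃⁱ[ℝ] EuclideanSpace ℝ (Fin 3), (∀ j : Fin N, dist (x N i) (x N j)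 ≤ R → ∃ z ∈ Literature.MathematicalPhysics.StatisticalMechanics.barlowStacking a h Literature.MathematicalPhysics.StatisticalMechanics.alternatingHagg, dist (x N j) (g z) ≤ ε) ∧ (∀ z ∈ Literature.MathematicalPhysics.StatisticalMechanics.barlowStacking a h Literature.MathematicalPhysics.StatisticalMechanics.alternatingHagg, dist (x N i) (g z) ≤ R → ∃ j : Fin N, dist (x N j) (g z) ≤ ε)} : ℝ) := by
  intro a h hW hCFW x hx R ε hR hε
  obtain ⟨δ₀, hδ₀, hsep⟩ := LennardJonesMinimalDistance_holds
  obtain ⟨η, β, L, ρ, hη, hβ, hL, hρ, hmain⟩ := hW δ₀ hδ₀ R ε hR hε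
  have hb := hCFW L hL x hx
  have hE := ChargedEnergyGapNegative.crysEnergyLimit
  refine ⟨ρ, hρ, Filter.Eventually.frequently ?_⟩
  have hb' := (tendsto_order.1 hb).2 β hβ
  have hE' := (tendsto_order.1 hE).2
    ((⨅ Q : PeriodicConfiguration 3, Q.energyPerParticle lennardJones) + η)
    (lt_add_of_pos_right _ hη)
  filter_upwards [hb', hE', eventually_gt_atTop 0] with N hbN hEN hpos
  have hNr : (0 : ℝ) < N := by exact_mod_cast hpos
  obtain ⟨hinj, hEq⟩ := hx N
  rw [div_lt_iff₀ hNr] at hbN hEN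
  refine hmain N (x N) hinj (fun i j hij => hsep N (x N) (hx N) i j hij) hbN.le ?_
  rw [hEq]
  linarith

end Summit.AtomisticToContinuum.Crystallization.Theorems.PricedHcpWindowsWeakSqueeze
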